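import Summits.Ventures.PercRepro0.AllOpen
import Mathlib.Probability.Independence.InfinitePi

/-!
# L4 · NONTRIVIAL, monotonicity in the dimension, kernel-checked against `Defs.lean` (seat p5):
`θ_d(p) ≤ θ_{d+1}(p)` and `p_c(d+1) ≤ p_c(d)`

Cell pub-perc-repro0, seat p2.  GLUE-p2-v2 L4(ii) in its `d → d+1` form: the coordinate hyperplane
`ℤ^d × {0} ⊂ ℤ^{d+1}` carries the bonds of `ℤ^d`; restricting a `(d+1)`-dimensional configuration to those
bonds has law `P_p^{(d)}` (`map_resCfg`: `setBernoulli` is an infinite product, and restriction along an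
injection of the index set is again the product, `Measure.map_infinitePi_infinitePi_of_inj`); an open
path in the hyperplane is an open path in `ℤ^{d+1}` (`conn_emb`); hence `{0 ↔ ∞}` only grows
(`percolates_subset`), `θ_d ≤ θ_{d+1}` (`thetaI_le_succ`) and `p_c(d+1) ≤ p_c(d)` (`pc_succ_le`).
-/

open MeasureTheory ProbabilityTheory unitInterval
open scoped ENNReal Topology

namespace Summit.Ventures.PercRepro0.L2

open Summit.Ventures.PercRepro0.Defs

variable {d : ℕ}

-- BEGIN BODY

/-! ### The coordinate embedding -/

/-- The coordinate embedding `ℤ^d → ℤ^{d+1}`, `x ↦ (x, 0)`. -/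
def emb (x : Vertex d) : Vertex (d + 1) := Fin.snoc x 0

/-- `emb` is injective. -/
lemma emb_injective : Function.Injective (emb (d := d)) := by
  intro x y h
  have := congrArg Fin.init h
  simpa [emb, Fin.init_snoc] using this

/-- `emb 0 = 0`. -/
lemma emb_zero : emb (0 : Vertex d) = 0 := by
  funext j
  refine Fin.lastCases ?_ (fun i => ?_) j
  · simp [emb]
  · simp [emb]

/-- `emb` preserves and reflects lattice adjacency. -/
lemma adj_emb_iff (x y : Vertex d) : (lattice (d + 1)).Adj (emb x) (emb y) ↔ (lattice d).Adj x y := by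
  show (∑ j, |emb x j - emb y j|) = 1 ↔ (∑ j, |x j - y j|) = 1
  rw [Fin.sum_univ_castSucc]
  simp [emb]

/-- The induced map on bonds. -/
def embE (e : Sym2 (Vertex d)) : Sym2 (Vertex (d + 1)) := Sym2.map emb e

/-- `embE` is injective. -/
lemma embE_injective : Function.Injective (embE (d := d)) := Sym2.map.injective emb_injective

/-- `embE` preserves and reflects membership in the bond set. -/
lemma embE_mem_bonds_iff (e : Sym2 (Vertex d)) : embE e ∈ bonds (d + 1) ↔ e ∈ bonds d := by
  induction e using Sym2.ind with
  | h x y =>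
    simp only [embE, Sym2.map_mk, bonds, SimpleGraph.mem_edgeSet]
    exact adj_emb_iff x y

/-- Restriction of a `(d+1)`-dimensional configuration to the bonds of the hyperplane. -/
def resCfg (ω : Config (d + 1)) : Config d := {e | embE e ∈ ω}

/-- `resCfg` is measurable. -/
lemma measurable_resCfg : Measurable (resCfg (d := d)) :=
  measurable_set_iff.2 fun e => measurable_set_mem (embE e)

/-- The one-bond factor of `setBernoulli` is the same for `e` and `embE e`. -/
lemma factor_embE (p : I) (e : Sym2 (Vertex d)) :
    (toNNReal p • Measure.dirac (embE e ∈ bonds (d + 1)) + toNNReal (σ p) • Measure.dirac False) =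
      (toNNReal p • Measure.dirac (e ∈ bonds d) + toNNReal (σ p) • Measure.dirac False) := by
  rw [propext (embE_mem_bonds_iff e)]

/-- The restriction of `P_p^{(d+1)}` to the hyperplane is `P_p^{(d)}`. -/
lemma map_resCfg (p : I) : (P (d + 1) p).map resCfg = P d p := by
  unfold P
  rw [setBernoulli_eq_map, setBernoulli_eq_map,
    Measure.map_map measurable_resCfg measurable_setOf]
  have hcomp : resCfg ∘ (fun q : Sym2 (Vertex (d + 1)) → Prop => {i | q i}) =
      (fun q : Sym2 (Vertex d) → Prop => {i | q i}) ∘ (fun q i => q (embE i)) := by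
    funext q; rfl
  rw [hcomp, ← Measure.map_map measurable_setOf (measurable_pi_lambda _ fun e =>
    measurable_pi_apply (embE e)),
    Measure.map_infinitePi_infinitePi_of_inj embE_injective]
  have hf : (fun i : Sym2 (Vertex d) => toNNReal p • Measure.dirac (embE i ∈ bonds (d + 1)) +
      toNNReal (σ p) • Measure.dirac False) =
      fun i => toNNReal p • Measure.dirac (i ∈ bonds d) + toNNReal (σ p) • Measure.dirac False :=
    funext fun e => factor_embE p e
  rw [hf]

/-- Open connections in the hyperplane are open connections in `ℤ^{d+1}`. -/
lemma conn_emb {ω : Config (d + 1)} {x y : Vertex d} (h : Conn d (resCfg ω) x y) :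
    Conn (d + 1) ω (emb x) (emb y) := by
  rw [conn_iff_reflTransGen] at h ⊢
  induction h with
  | refl => exact Relation.ReflTransGen.refl
  | tail _ hadj ih =>
    refine ih.tail ⟨(adj_emb_iff _ _).2 hadj.1, ?_⟩
    have := hadj.2
    simpa [resCfg, embE] using this

/-- If the origin percolates in the hyperplane it percolates in `ℤ^{d+1}`. -/
lemma percolates_subset : resCfg ⁻¹' percolates d ⊆ percolates (d + 1) := by
  intro ω hω
  have hinf : (cluster d (resCfg ω) 0).Infinite := hω
  have himg : (emb '' cluster d (resCfg ω) 0).Infinite := hinf.image emb_injective.injOn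
  refine himg.mono ?_
  rintro _ ⟨y, hy, rfl⟩
  have := conn_emb (ω := ω) hy
  rw [emb_zero] at this
  exact this

/-- `θ_d(p) ≤ θ_{d+1}(p)`. -/
theorem thetaI_le_succ (p : I) : thetaI d p ≤ thetaI (d + 1) p := by
  unfold thetaI
  rw [← map_resCfg p, Measure.map_apply measurable_resCfg measurableSet_percolates]
  exact ENNReal.toReal_mono (measure_ne_top _ _) (measure_mono percolates_subset)

/-- `θ_d(p) ≤ θ_{d+1}(p)` on `ℝ`. -/
theorem theta_le_succ (p : ℝ) : theta d p ≤ theta (d + 1) p := thetaI_le_succ _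

/-- L4(ii): `p_c(d+1) ≤ p_c(d)`, given that `{p ∈ [0,1] : θ_d(p) > 0}` is nonempty (i.e. `θ_d(1) = 1`,
p5's `thetaI_one`; `d ≥ 1`). -/
theorem pc_succ_le (hne : (pcSet d).Nonempty) : pc (d + 1) ≤ pc d := by
  refine csInf_le_csInf ⟨0, fun q hq => hq.1.1⟩ hne fun q hq => ?_
  exact ⟨hq.1, lt_of_lt_of_le hq.2 (theta_le_succ q)⟩

/-! ### Assembly of L4 · NONTRIVIAL -/

/-- `p_c(d) ≤ p_c(2)` for `d ≥ 2` (iterating `pc_succ_le`). -/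
theorem pc_le_pc_two (hne : ∀ d', 1 ≤ d' → (pcSet d').Nonempty) (hd : 2 ≤ d) : pc d ≤ pc 2 := by
  induction d with
  | zero => omega
  | succ k ih =>
    rcases Nat.lt_or_ge k 2 with hk | hk
    · have : k + 1 = 2 := by omega
      rw [this]
    · exact (pc_succ_le (hne k (by omega))).trans (ih hk)

/-- Lean twin of `Defs.L4_Nontrivial d` (`d ≥ 2`), given `p_c(2) < 1` (from T2, p4's `T2_Planar_of`) and
the nonemptiness of `{p ∈ [0,1] : θ_{d'}(p) > 0}` for all `d' ≥ 1` (from `θ_{d'}(1) = 1`, p5's `thetaI_one`). -/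
theorem L4_Nontrivial_of (hd : 2 ≤ d) (hpc2 : pc 2 < 1)
    (hne : ∀ d', 1 ≤ d' → (pcSet d').Nonempty) : L4_Nontrivial d :=
  ⟨⟨inv_two_d_sub_one_le_pc (by omega) (hne d (by omega)),
    lt_of_le_of_lt (pc_le_pc_two hne hd) hpc2⟩, pc_succ_le (hne d (by omega))⟩

/-- Lean twin of `Defs.L4_Nontrivial d` (`d ≥ 2`), given only `p_c(2) < 1` (T2). -/
theorem L4_Nontrivial_of' (hd : 2 ≤ d) (hpc2 : pc 2 < 1) : L4_Nontrivial d :=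
  L4_Nontrivial_of hd hpc2 fun _ hd' => pcSet_nonempty hd'

-- END BODY

end Summit.Ventures.PercRepro0.L2
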